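import Mathlib
import HarnessLib
import Summits.AtomisticToContinuum.Crystallization.Theorems.PricedLinkCensusSoftFourRingsCapTypeACell
import Summits.AtomisticToContinuum.Crystallization.Theorems.PricedLinkCensusSoftFourRingsTypeOA
import Summits.AtomisticToContinuum.Crystallization.Theorems.PricedLinkCensusSoftFourRingsBridge
import Summits.AtomisticToContinuum.Crystallization.Theorems.PricedLinkCensusSoftFourRingsTypeData

/-!
# Soft four-rings, endgame: point-level type data of a vertex

Support file for `SoftFourRings` (route `PricedLinkCensus`, sub-problem `Crystallization`),
endgame steps (E1)–(E3) of the evidence file (§12.8), in enumeration-free form.  At zero slack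
(conditional on Tammes-13) every vertex `v` is of exactly one of two kinds (`type_cases`):

* **type A** with data `(a, b, c, d)`: `N(v) = {a, b, c, d}`, bonds `a ∼ b ∼ c`, and
  `a ≁ c, a ≁ d, b ≁ d, c ≁ d` (`b` = `α`-partner, `a, c` = wings, `d` = `γ`-partner);
* **type O** with data `(a, b, c, d)`: `N(v) = {a, b, c, d}`, bonds `a ∼ b`, `c ∼ d`, and the
  other four pairs non-bonds.

`typeA_cells` restates the cell lemma `typeA_common_neighbours` for type-A data: the `γ`-partner
`d` has common bonds `x, x' ∉ N[v]` with the wings `a` and `c`, through facets that are not bond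
triangles.

**`Cap` variant** (seat c3 of stmt-AtomisticToContinuum-14234): identical to `PricedLinkCensusSoftFourRingsTypeData`, except that the
global Tammes-13 hypothesis `(hT : musinTarasov2012_tammes_thirteen)` is replaced by the LOCAL covering
property of the twelve directions, `hT : ∀ p, ‖p‖ = 1 → ∃ x ∈ X, dist p x < 0.957` (no empty cap of
angular radius `57.18°`), which is all the two roots (`FacetCap`, `Interior`) ever used; the hT-free
lemmas are not repeated (the original file is imported for them).
-/

namespace Summit.AtomisticToContinuum.Crystallization.Theorems.Cap

open Real RealInnerProductSpace Literature.Geometry.DiscreteGeometry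

section Setting

open scoped Classical in
/-- **Every vertex is of type A or of type O** (see the module docstring). -/
theorem type_cases
    {X : Finset (EuclideanSpace ℝ (Fin 3))}
    {B : Finset (Finset (EuclideanSpace ℝ (Fin 3)))}
    (hT : ∀ p : EuclideanSpace ℝ (Fin 3), ‖p‖ = 1 → ∃ x ∈ X, dist p x < 0.957)
    (hX1 : ∀ y ∈ X, ‖y‖ = 1)
    (hcard : X.card = 12)
    (hsepX : ∀ u ∈ X, ∀ u' ∈ X, u ≠ u' → ⟪u, u'⟫ ≤ 1 - 1 / (2 * (101 / 100 : ℝ) ^ 2))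
    (hB : ∀ T ∈ B, ∃ u ∈ X, ∃ u' ∈ X, u ≠ u' ∧ 1 - (101 / 100 : ℝ) ^ 2 / 2 ≤ ⟪u, u'⟫ ∧ T = {u, u'})
    (hBcard : B.card = 24)
    (hdeg : ∀ v ∈ X, ∃ w : Fin 4 → EuclideanSpace ℝ (Fin 3), (∀ k, w k ∈ X) ∧ Function.Injective w ∧ (∀ k, w k ≠ v) ∧ (∀ k, ({v, w k} : Finset (EuclideanSpace ℝ (Fin 3))) ∈ B) ∧ ∀ y, ({v, y} : Finset (EuclideanSpace ℝ (Fin 3))) ∈ B → ∃ k, y = w k) {v : EuclideanSpace ℝ (Fin 3)} (hv : v ∈ X) :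
    (∃ a b c d : EuclideanSpace ℝ (Fin 3),
      (∀ y, ({v, y} : Finset (EuclideanSpace ℝ (Fin 3))) ∈ B ↔ (y = a ∨ y = b ∨ y = c ∨ y = d)) ∧
      (a ≠ b ∧ a ≠ c ∧ a ≠ d ∧ b ≠ c ∧ b ≠ d ∧ c ≠ d) ∧
      ({a, b} : Finset (EuclideanSpace ℝ (Fin 3))) ∈ B ∧
      ({b, c} : Finset (EuclideanSpace ℝ (Fin 3))) ∈ B ∧
      ({a, c} : Finset (EuclideanSpace ℝ (Fin 3))) ∉ B ∧
      ({a, d} : Finset (EuclideanSpace ℝ (Fin 3))) ∉ B ∧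
      ({b, d} : Finset (EuclideanSpace ℝ (Fin 3))) ∉ B ∧
      ({c, d} : Finset (EuclideanSpace ℝ (Fin 3))) ∉ B) ∨
    (∃ a b c d : EuclideanSpace ℝ (Fin 3),
      (∀ y, ({v, y} : Finset (EuclideanSpace ℝ (Fin 3))) ∈ B ↔ (y = a ∨ y = b ∨ y = c ∨ y = d)) ∧
      (a ≠ b ∧ a ≠ c ∧ a ≠ d ∧ b ≠ c ∧ b ≠ d ∧ c ≠ d) ∧
      ({a, b} : Finset (EuclideanSpace ℝ (Fin 3))) ∈ B ∧
      ({c, d} : Finset (EuclideanSpace ℝ (Fin 3))) ∈ B ∧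
      ({a, c} : Finset (EuclideanSpace ℝ (Fin 3))) ∉ B ∧
      ({a, d} : Finset (EuclideanSpace ℝ (Fin 3))) ∉ B ∧
      ({b, c} : Finset (EuclideanSpace ℝ (Fin 3))) ∉ B ∧
      ({b, d} : Finset (EuclideanSpace ℝ (Fin 3))) ∉ B) := by
  obtain ⟨h0, -⟩ := hull_counts_of_twelve hT hX1 hcard hsepX hB hBcard
  obtain ⟨-, ht2⟩ := no_slack_one_percent hT hX1 hcard hsepX hB hBcard hdeg
  obtain ⟨w, hwX, hwinj, hwv, hvw, hvonly⟩ := hdeg v hv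
  obtain ⟨i₁, j₁, i₂, j₂, h₁, h₂, hne, hB₁, hB₂, hall⟩ :=
    bondedPairs_of_two_bondTriangles_at hX1 h0 hsepX hB hv w hwX hwinj hwv hvw hvonly (ht2 v hv)
  obtain ⟨i, j, k, l, hnd, hp, hq⟩ := fin_four_pairs_dichotomy h₁ h₂ hne
  have hnd' : (i ≠ j ∧ i ≠ k ∧ i ≠ l) ∧ (j ≠ k ∧ j ≠ l) ∧ k ≠ l := by
    simp only [List.nodup_cons, List.mem_cons, not_or, List.not_mem_nil,
      not_false_eq_true, and_true, List.nodup_nil] at hnd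
    exact hnd
  have hN : ∀ y, ({v, y} : Finset (EuclideanSpace ℝ (Fin 3))) ∈ B ↔
      (y = w i ∨ y = w j ∨ y = w k ∨ y = w l) := by
    intro y
    constructor
    · intro hy
      obtain ⟨m, rfl⟩ := hvonly y hy
      rcases fin_four_eq_of_nodup i j k l hnd m with rfl | rfl | rfl | rfl
      · exact Or.inl rfl
      · exact Or.inr (Or.inl rfl)
      · exact Or.inr (Or.inr (Or.inl rfl))
      · exact Or.inr (Or.inr (Or.inr rfl))
    · rintro (rfl | rfl | rfl | rfl) <;> exact hvw _
  have hdist : w i ≠ w j ∧ w i ≠ w k ∧ w i ≠ w l ∧ w j ≠ w k ∧ w j ≠ w l ∧ w k ≠ w l :=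
    ⟨fun h => hnd'.1.1 (hwinj h), fun h => hnd'.1.2.1 (hwinj h), fun h => hnd'.1.2.2 (hwinj h),
      fun h => hnd'.2.1.1 (hwinj h), fun h => hnd'.2.1.2 (hwinj h), fun h => hnd'.2.2 (hwinj h)⟩
  have hBij : ({w i, w j} : Finset (EuclideanSpace ℝ (Fin 3))) ∈ B := by
    rw [← image_pair_eq hp]; exact hB₁
  -- a non-bond test: a bonded pair `{w a, w b}` has index pair `{i₁, j₁}` or `{i₂, j₂}`
  have hnb : ∀ a b : Fin 4, a ≠ b → ({a, b} : Finset (Fin 4)) ≠ {i₁, j₁} →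
      ({a, b} : Finset (Fin 4)) ≠ {i₂, j₂} →
      ({w a, w b} : Finset (EuclideanSpace ℝ (Fin 3))) ∉ B := by
    intro a b hab h1 h2 hBab
    rcases hall a b hab hBab with h | h
    · exact h1 h
    · exact h2 h
  -- index-pair inequalities from `Nodup`
  have hpne : ∀ {a b c d : Fin 4}, (a ≠ c ∧ a ≠ d) ∨ (b ≠ c ∧ b ≠ d) →
      ({a, b} : Finset (Fin 4)) ≠ {c, d} := by
    intro a b c d h he
    rcases finset_pair_eq_pair_iff.1 he with ⟨rfl, rfl⟩ | ⟨rfl, rfl⟩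
    · rcases h with ⟨h1, -⟩ | ⟨-, h2⟩
      · exact h1 rfl
      · exact h2 rfl
    · rcases h with ⟨-, h1⟩ | ⟨h2, -⟩
      · exact h1 rfl
      · exact h2 rfl
  rcases hq with hq | hq
  · -- type O: pairs `{i, j}` and `{k, l}`
    right
    have hBkl : ({w k, w l} : Finset (EuclideanSpace ℝ (Fin 3))) ∈ B := by
      rw [← image_pair_eq hq]; exact hB₂
    refine ⟨w i, w j, w k, w l, hN, hdist, hBij, hBkl, ?_, ?_, ?_, ?_⟩
    · refine hnb i k hnd'.1.2.1 (hp ▸ hpne ?_) (hq ▸ hpne ?_)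
      · exact Or.inr ⟨hnd'.1.2.1.symm, hnd'.2.1.1.symm⟩
      · exact Or.inl ⟨hnd'.1.2.1, hnd'.1.2.2⟩
    · refine hnb i l hnd'.1.2.2 (hp ▸ hpne ?_) (hq ▸ hpne ?_)
      · exact Or.inr ⟨hnd'.1.2.2.symm, hnd'.2.1.2.symm⟩
      · exact Or.inl ⟨hnd'.1.2.1, hnd'.1.2.2⟩
    · refine hnb j k hnd'.2.1.1 (hp ▸ hpne ?_) (hq ▸ hpne ?_)
      · exact Or.inr ⟨hnd'.1.2.1.symm, hnd'.2.1.1.symm⟩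
      · exact Or.inl ⟨hnd'.2.1.1, hnd'.2.1.2⟩
    · refine hnb j l hnd'.2.1.2 (hp ▸ hpne ?_) (hq ▸ hpne ?_)
      · exact Or.inr ⟨hnd'.1.2.2.symm, hnd'.2.1.2.symm⟩
      · exact Or.inl ⟨hnd'.2.1.1, hnd'.2.1.2⟩
  · -- type A: pairs `{i, j}` and `{j, k}`
    left
    have hBjk : ({w j, w k} : Finset (EuclideanSpace ℝ (Fin 3))) ∈ B := by
      rw [← image_pair_eq hq]; exact hB₂
    refine ⟨w i, w j, w k, w l, hN, hdist, hBij, hBjk, ?_, ?_, ?_, ?_⟩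
    · refine hnb i k hnd'.1.2.1 (hp ▸ hpne ?_) (hq ▸ hpne ?_)
      · exact Or.inr ⟨hnd'.1.2.1.symm, hnd'.2.1.1.symm⟩
      · exact Or.inl ⟨hnd'.1.1, hnd'.1.2.1⟩
    · refine hnb i l hnd'.1.2.2 (hp ▸ hpne ?_) (hq ▸ hpne ?_)
      · exact Or.inr ⟨hnd'.1.2.2.symm, hnd'.2.1.2.symm⟩
      · exact Or.inl ⟨hnd'.1.1, hnd'.1.2.1⟩
    · refine hnb j l hnd'.2.1.2 (hp ▸ hpne ?_) (hq ▸ hpne ?_)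
      · exact Or.inr ⟨hnd'.1.2.2.symm, hnd'.2.1.2.symm⟩
      · exact Or.inr ⟨hnd'.2.1.2.symm, hnd'.2.2.symm⟩
    · refine hnb k l hnd'.2.2 (hp ▸ hpne ?_) (hq ▸ hpne ?_)
      · exact Or.inl ⟨hnd'.1.2.1.symm, hnd'.2.1.1.symm⟩
      · exact Or.inr ⟨hnd'.2.1.2.symm, hnd'.2.2.symm⟩

open scoped Classical in
/-- **The cells at a type-A vertex, point form**: with type-A data `(a, b, c, d)` at `v`, the
`γ`-partner `d` has a common bond `x ∉ N[v]` with the wing `a` and a common bond `x' ∉ N[v]`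
with the wing `c`, through facets `{x, d} ⊆ f`, `{x', d} ⊆ f'` that are not bond triangles. -/
theorem typeA_cells
    {X : Finset (EuclideanSpace ℝ (Fin 3))}
    {B : Finset (Finset (EuclideanSpace ℝ (Fin 3)))}
    (hT : ∀ p : EuclideanSpace ℝ (Fin 3), ‖p‖ = 1 → ∃ x ∈ X, dist p x < 0.957)
    (hX1 : ∀ y ∈ X, ‖y‖ = 1)
    (hcard : X.card = 12)
    (hsepX : ∀ u ∈ X, ∀ u' ∈ X, u ≠ u' → ⟪u, u'⟫ ≤ 1 - 1 / (2 * (101 / 100 : ℝ) ^ 2))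
    (hB : ∀ T ∈ B, ∃ u ∈ X, ∃ u' ∈ X, u ≠ u' ∧ 1 - (101 / 100 : ℝ) ^ 2 / 2 ≤ ⟪u, u'⟫ ∧ T = {u, u'})
    (hBcard : B.card = 24)
    (hdeg : ∀ v ∈ X, ∃ w : Fin 4 → EuclideanSpace ℝ (Fin 3), (∀ k, w k ∈ X) ∧ Function.Injective w ∧ (∀ k, w k ≠ v) ∧ (∀ k, ({v, w k} : Finset (EuclideanSpace ℝ (Fin 3))) ∈ B) ∧ ∀ y, ({v, y} : Finset (EuclideanSpace ℝ (Fin 3))) ∈ B → ∃ k, y = w k) {v a b c d : EuclideanSpace ℝ (Fin 3)} (hv : v ∈ X)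
    (hN : ∀ y, ({v, y} : Finset (EuclideanSpace ℝ (Fin 3))) ∈ B ↔ (y = a ∨ y = b ∨ y = c ∨ y = d))
    (hd : a ≠ b ∧ a ≠ c ∧ a ≠ d ∧ b ≠ c ∧ b ≠ d ∧ c ≠ d)
    (hab : ({a, b} : Finset (EuclideanSpace ℝ (Fin 3))) ∈ B)
    (hbc : ({b, c} : Finset (EuclideanSpace ℝ (Fin 3))) ∈ B)
    (hac : ({a, c} : Finset (EuclideanSpace ℝ (Fin 3))) ∉ B)
    (had : ({a, d} : Finset (EuclideanSpace ℝ (Fin 3))) ∉ B)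
    (hbd : ({b, d} : Finset (EuclideanSpace ℝ (Fin 3))) ∉ B)
    (hcd : ({c, d} : Finset (EuclideanSpace ℝ (Fin 3))) ∉ B) :
    (∃ x ∈ X, x ≠ v ∧ x ≠ a ∧ x ≠ b ∧ x ≠ c ∧ x ≠ d ∧
      ({x, d} : Finset (EuclideanSpace ℝ (Fin 3))) ∈ B ∧
      ({x, a} : Finset (EuclideanSpace ℝ (Fin 3))) ∈ B ∧
      ∃ c₀ ∈ facetNormals X, x ∈ tightSet X c₀ ∧ d ∈ tightSet X c₀ ∧
        ¬ ((tightSet X c₀).card = 3 ∧ ((edgesOfFacet X c₀).filter (fun T => T ∉ B)).card = 0)) ∧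
    (∃ x ∈ X, x ≠ v ∧ x ≠ a ∧ x ≠ b ∧ x ≠ c ∧ x ≠ d ∧
      ({x, d} : Finset (EuclideanSpace ℝ (Fin 3))) ∈ B ∧
      ({x, c} : Finset (EuclideanSpace ℝ (Fin 3))) ∈ B ∧
      ∃ c₀ ∈ facetNormals X, x ∈ tightSet X c₀ ∧ d ∈ tightSet X c₀ ∧
        ¬ ((tightSet X c₀).card = 3 ∧ ((edgesOfFacet X c₀).filter (fun T => T ∉ B)).card = 0)) := by
  obtain ⟨hab', hac', had', hbc', hbd', hcd'⟩ := hd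
  set w : Fin 4 → EuclideanSpace ℝ (Fin 3) := ![a, b, c, d] with hw
  have hw0 : w 0 = a := rfl
  have hw1 : w 1 = b := rfl
  have hw2 : w 2 = c := rfl
  have hw3 : w 3 = d := rfl
  have hwinj : Function.Injective w := injective_vec4 hab' hac' had' hbc' hbd' hcd'
  have hvw : ∀ k, ({v, w k} : Finset (EuclideanSpace ℝ (Fin 3))) ∈ B := by
    intro k
    fin_cases k
    · exact (hN a).2 (Or.inl rfl)
    · exact (hN b).2 (Or.inr (Or.inl rfl))
    · exact (hN c).2 (Or.inr (Or.inr (Or.inl rfl)))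
    · exact (hN d).2 (Or.inr (Or.inr (Or.inr rfl)))
  have hwX : ∀ k, w k ∈ X := fun k => (mem_of_mem_bonds hB (hvw k)).2
  have hwv : ∀ k, w k ≠ v := fun k => (ne_of_mem_bonds hB (hvw k)).symm
  have hvonly : ∀ y, ({v, y} : Finset (EuclideanSpace ℝ (Fin 3))) ∈ B → ∃ k, y = w k := by
    intro y hy
    rw [exists_fin_four_iff]
    exact (hN y).1 hy
  have hnd : [(0 : Fin 4), 1, 2, 3].Nodup := by decide
  have hBij : ({w 0, w 1} : Finset (EuclideanSpace ℝ (Fin 3))) ∈ B := hab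
  have hBjk : ({w 1, w 2} : Finset (EuclideanSpace ℝ (Fin 3))) ∈ B := hbc
  have hNB : ∀ p q : Fin 4, p ≠ q → ({w p, w q} : Finset (EuclideanSpace ℝ (Fin 3))) ∈ B →
      ({p, q} : Finset (Fin 4)) = {0, 1} ∨ ({p, q} : Finset (Fin 4)) = {1, 2} := by
    intro p q _ hBpq
    fin_cases p <;> fin_cases q
    all_goals
      simp only [hw, Fin.zero_eta, Fin.mk_one, Fin.isValue, Fin.reduceFinMk,
        Matrix.cons_val_zero, Matrix.cons_val_one, Matrix.cons_val] at hBpq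
    all_goals first
      | (left; decide)
      | (right; decide)
      | (exfalso; exact (ne_of_mem_bonds hB hBpq) rfl)
      | (exfalso; exact hac hBpq)
      | (exfalso; exact had hBpq)
      | (exfalso; exact hbd hBpq)
      | (exfalso; exact hcd hBpq)
      | (exfalso; rw [Finset.pair_comm] at hBpq; exact hac hBpq)
      | (exfalso; rw [Finset.pair_comm] at hBpq; exact had hBpq)
      | (exfalso; rw [Finset.pair_comm] at hBpq; exact hbd hBpq)
      | (exfalso; rw [Finset.pair_comm] at hBpq; exact hcd hBpq)
  obtain ⟨⟨x, hxX, hxv, hxw, hBxl, hBxi, hf⟩, ⟨x', hx'X, hx'v, hx'w, hBx'l, hBx'k, hf'⟩⟩ :=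
    typeA_common_neighbours hT hX1 hcard hsepX hB hBcard hdeg hv w hwX hwinj hwv hvw hvonly hnd
      hBij hBjk hNB (i := 0) (j := 1) (k := 2) (l := 3)
  exact ⟨⟨x, hxX, hxv, hxw 0, hxw 1, hxw 2, hxw 3, hBxl, hBxi, hf⟩,
    ⟨x', hx'X, hx'v, hx'w 0, hx'w 1, hx'w 2, hx'w 3, hBx'l, hBx'k, hf'⟩⟩

end Setting

end Summit.AtomisticToContinuum.Crystallization.Theorems.Cap
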